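import Literature.MathematicalPhysics.QuantumLattice.LiebRobinsonFnwGapOverlapProofs
import Literature.MathematicalPhysics.QuantumLattice.LiebRobinsonFnwGapChainProofs
import Literature.MathematicalPhysics.QuantumLattice.LiebRobinsonFnwGapProjectionsProofs
import HarnessLib

/-!
# The cross term of two neighbouring coarse-grained projections on a chain (FNW Thm. 6.4, step)

Sibling proof file of `Literature/MathematicalPhysics/QuantumLattice/LiebRobinson.lean`
(theorem-only: no definition, no named fact), a step towards the discharge of
`fannes_nachtergaele_werner_gap` (**hubbard.S16**; Fannes–Nachtergaele–Werner 1992, Thm. 6.4),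
continuing `LiebRobinsonFnwGapOverlapProofs.lean` (FNW Lemma 6.2),
`LiebRobinsonFnwGapProjectionsProofs.lean` (FNW Lemma 6.3) and `LiebRobinsonFnwGapChainProofs.lean`
(FNW Lemma 5.5 / Thm. 5.8 on the open chain).

* `posSemidef_pair_chain` — on the open chain of `a + b + c` sites, in the normalised gauge, the
  prefix and suffix parent projections `E = h_{a+b} ⊗ 𝟙_c`, `F = 𝟙_a ⊗ h_{b+c}` satisfy
  `E F + F E + ε' (E + F) ≥ 0` as soon as the transfer-operator iterates at the lengths `b`, `a+b`,
  `b+c` are `δ`-close (entrywise) to their rank-one limit, with `ε' (1 - ε) = ε` and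
  `ε = (2/λ)(δ D² λ^{-1/2} + δ² D⁴ λ^{-5/2})`. This is the estimate of the cross terms
  `|i - j| = 1` in FNW's proof of Thm. 6.4 (p. 479: "using successively Lemmas 6.3.(2), 6.3.(1),
  5.5, and 6.2"): with `G₁ = 𝟙 - E`, `G₂ = 𝟙 - F`, `G = G_{a+b+c} ≤ G₁ ∧ G₂` and the angle bound
  `‖(G₁ - G)(G₂ - G)‖ ≤ ε` of Lemma 6.2 (`fnw_overlap_le`), the two-projection Lemma 6.3
  (`posSemidef_anticommutator_add_smul`) gives the claim.
* Glue: `extend_prefix_append`, `extend_suffix_append`, `sum_sum_sum_append` read a configuration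
  of the chain as three concatenated words (prefix block = first two words, suffix block = last
  two words).

## Source

* M. Fannes, B. Nachtergaele, R. F. Werner, *Finitely correlated states on quantum spin chains*,
  Comm. Math. Phys. **144** (1992) 443–490, §6, Thm. 6.4 and its proof (p. 479), Lemma 6.2
  (p. 476), Lemma 6.3 (p. 478), Lemma 5.5. [FannesNachtergaeleWernerCMP1992]
-/

noncomputable section

open Matrix
open scoped ComplexOrder MatrixOrder InnerProductSpace

namespace Literature.MathematicalPhysics.QuantumLattice

section QLattice

variable {q D : ℕ}

/-! ### Gluing three words and reading off prefix / suffix blocks -/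

/-- An index of `Fin (m + n)` below `m` is a `castAdd`. [folklore] -/
theorem fin_eq_castAdd {m n : ℕ} (j : Fin (m + n)) (h : (j : ℕ) < m) :
    j = Fin.castAdd n ⟨j, h⟩ := Fin.ext rfl

/-- An index of `Fin (m + n)` at least `m` is a `natAdd`. [folklore] -/
theorem fin_eq_natAdd {m n : ℕ} (j : Fin (m + n)) (h : m ≤ (j : ℕ)) :
    j = Fin.natAdd m ⟨j - m, by omega⟩ := Fin.ext (by simp; omega)

/-- Evaluating `Fin.append` below the cut. [folklore] -/
theorem append_apply_lt {α : Type*} {m n : ℕ} (u : Fin m → α) (v : Fin n → α) (j : Fin (m + n))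
    (h : (j : ℕ) < m) : Fin.append u v j = u ⟨j, h⟩ := by
  conv_lhs => rw [fin_eq_castAdd j h]
  rw [Fin.append_left]

/-- Evaluating `Fin.append` above the cut. [folklore] -/
theorem append_apply_ge {α : Type*} {m n : ℕ} (u : Fin m → α) (v : Fin n → α) (j : Fin (m + n))
    (h : m ≤ (j : ℕ)) : Fin.append u v j = v ⟨j - m, by omega⟩ := by
  conv_lhs => rw [fin_eq_natAdd j h]
  rw [Fin.append_right]

/-- **Gluing along the prefix block.** Gluing a word `v` of length `a + b` into the prefix block
`{0, …, a+b-1}` of a glued configuration `(u ++ s) ++ t` gives `v ++ t`. [folklore] -/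
theorem extend_prefix_append {a b c : ℕ} (x₀ : Fin (a + b + c)) (hx₀ : (x₀ : ℕ) = 0)
    (v : Fin (a + b) → Fin q) (u : Fin a → Fin q) (s : Fin b → Fin q) (t : Fin c → Fin q) :
    Function.extend (fun i : Fin (a + b) => (⟨x₀ + i, by omega⟩ : Fin (a + b + c))) v
        (Fin.append (Fin.append u s) t) = Fin.append v t := by
  have hinj : Function.Injective fun i : Fin (a + b) => (⟨x₀ + i, by omega⟩ : Fin (a + b + c)) := by
    intro i i' h
    have := congrArg Fin.val h
    simp at this
    exact Fin.ext this
  funext j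
  by_cases hj : (j : ℕ) < a + b
  · have e : j = (⟨x₀ + ((⟨j, hj⟩ : Fin (a + b)) : ℕ), by omega⟩ : Fin (a + b + c)) :=
      Fin.ext (by simp; omega)
    conv_lhs => rw [e]
    rw [hinj.extend_apply, append_apply_lt _ _ j hj]
  · rw [Function.extend_apply' _ _ _ (by
      rintro ⟨i, hi⟩
      have := congrArg Fin.val hi
      simp at this
      omega)]
    push Not at hj
    rw [append_apply_ge _ _ j hj, append_apply_ge _ _ j hj]

/-- **Gluing along the suffix block.** Gluing a word `s ++ t` of length `b + c` into the suffix
block `{a, …, a+b+c-1}` of a glued configuration `(u ++ s') ++ t'` gives `(u ++ s) ++ t`. [folklore] -/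
theorem extend_suffix_append {a b c : ℕ} (x₁ : Fin (a + b + c)) (hx₁ : (x₁ : ℕ) = a)
    (u : Fin a → Fin q) (s s' : Fin b → Fin q) (t t' : Fin c → Fin q) :
    Function.extend (fun i : Fin (b + c) => (⟨x₁ + i, by omega⟩ : Fin (a + b + c))) (Fin.append s t)
        (Fin.append (Fin.append u s') t') = Fin.append (Fin.append u s) t := by
  have hinj : Function.Injective fun i : Fin (b + c) => (⟨x₁ + i, by omega⟩ : Fin (a + b + c)) := by
    intro i i' h
    have := congrArg Fin.val h
    simp at this
    exact Fin.ext this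
  funext j
  by_cases hj : (j : ℕ) < a
  · rw [Function.extend_apply' _ _ _ (by
      rintro ⟨i, hi⟩
      have := congrArg Fin.val hi
      simp at this
      omega)]
    have hj' : (j : ℕ) < a + b := by omega
    rw [append_apply_lt _ _ j hj', append_apply_lt _ _ j hj',
      append_apply_lt _ _ (⟨j, hj'⟩ : Fin (a + b)) hj, append_apply_lt _ _ (⟨j, hj'⟩ : Fin (a + b)) hj]
  · push Not at hj
    have e : j = (⟨x₁ + ((⟨j - a, by omega⟩ : Fin (b + c)) : ℕ), by omega⟩ : Fin (a + b + c)) :=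
      Fin.ext (by simp; omega)
    conv_lhs => rw [e]
    rw [hinj.extend_apply]
    by_cases hjb : (j : ℕ) < a + b
    · rw [append_apply_lt _ _ (⟨j - a, by omega⟩ : Fin (b + c))
        (show ((⟨j - a, _⟩ : Fin (b + c)) : ℕ) < b by simp; omega),
        append_apply_lt _ _ j hjb, append_apply_ge _ _ (⟨j, hjb⟩ : Fin (a + b)) hj]
    · push Not at hjb
      rw [append_apply_ge _ _ (⟨j - a, by omega⟩ : Fin (b + c))
        (show b ≤ ((⟨j - a, _⟩ : Fin (b + c)) : ℕ) by simp; omega),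
        append_apply_ge _ _ j hjb]
      congr 1
      exact Fin.ext (by simp; omega)

/-- Summing over glued configurations is summing over all configurations. [folklore] -/
theorem sum_sum_sum_append {M : Type*} [AddCommMonoid M] {a b c : ℕ}
    (f : (Fin (a + b + c) → Fin q) → M) :
    ∑ u : Fin a → Fin q, ∑ s : Fin b → Fin q, ∑ t : Fin c → Fin q,
      f (Fin.append (Fin.append u s) t) = ∑ w : Fin (a + b + c) → Fin q, f w := by
  calc ∑ u : Fin a → Fin q, ∑ s : Fin b → Fin q, ∑ t : Fin c → Fin q,
        f (Fin.append (Fin.append u s) t)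
      = ∑ w : Fin (a + b) → Fin q, ∑ t : Fin c → Fin q, f (Fin.append w t) :=
        sum_sum_eq_sum_append (fun w : Fin (a + b) → Fin q => ∑ t : Fin c → Fin q, f (Fin.append w t))
    _ = ∑ w : Fin (a + b + c) → Fin q, f w := sum_sum_eq_sum_append f

/-! ### The cross term of two neighbouring coarse-grained projections -/

/-- **The cross term of FNW's Theorem 6.4 on a chain (neighbouring blocks).** In the normalised
gauge, on the chain of `a + b + c` sites let `E = h_{a+b} ⊗ 𝟙_c` and `F = 𝟙_a ⊗ h_{b+c}` be the
`(a+b)`-site and `(b+c)`-site parent projections `h_n = 𝟙 - G_n` placed on the prefix and the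
suffix block. If the transfer-operator iterates at the lengths `b`, `a+b`, `b+c` are within `δ`
(entrywise, `δ D² ≤ λ/2`) of their limit, and `ε ≥ (2/λ)(δ D² λ^{-1/2} + δ² D⁴ λ^{-5/2})`,
`ε' (1 - ε) = ε`, then `E F + F E + ε' (E + F) ≥ 0`. Proof: `G₁ = 𝟙 - E`, `G₂ = 𝟙 - F` and
`G = G_{a+b+c}` satisfy `G ≤ G₁, G₂` (FNW Lemma 5.5, trivial inclusion) and the angle bound
`|⟨(G₁ - G)x, (G₂ - G)y⟩| ≤ ε ‖(G₁ - G)x‖ ‖(G₂ - G)y‖` (`fnw_overlap_le`, FNW Lemma 6.2), so the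
two-projection lemma (`posSemidef_anticommutator_add_smul`, FNW Lemma 6.3) applies. This is the
chain "Lemmas 6.3.(2), 6.3.(1), 5.5, and 6.2" of FNW p. 479.
[cite: FannesNachtergaeleWernerCMP1992, Thm. 6.4] -/
theorem posSemidef_pair_chain (A : MPSTensor q D) {ρ : Matrix (Fin D) (Fin D) ℂ}
    (h1 : transferOp A 1 = 1) (hρ : transferOp (fun i => (A i)ᴴ) ρ = ρ)
    (hρ1 : (1 - ρ).PosSemidef) {lam : ℝ} (hlam : 0 < lam)
    (hlamρ : (ρ - (lam : ℂ) • (1 : Matrix (Fin D) (Fin D) ℂ)).PosSemidef)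
    {a b c : ℕ} (x₀ : Fin (a + b + c)) (hx₀ : (x₀ : ℕ) = 0) (h₀ : (x₀ : ℕ) + (a + b) ≤ a + b + c)
    (x₁ : Fin (a + b + c)) (hx₁ : (x₁ : ℕ) = a) (h₁ : (x₁ : ℕ) + (b + c) ≤ a + b + c)
    {δ ε ε' : ℝ} (hδ0 : 0 ≤ δ) (hδlam : δ * (D : ℝ) ^ 2 ≤ lam / 2)
    (hδb : ∀ a' d' i j : Fin D, ‖((transferOp A ^ b) (Matrix.single a' d' 1) -
      ρ d' a' • (1 : Matrix (Fin D) (Fin D) ℂ)) i j‖ ≤ δ)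
    (hδab : ∀ a' d' i j : Fin D, ‖((transferOp A ^ (a + b)) (Matrix.single a' d' 1) -
      ρ d' a' • (1 : Matrix (Fin D) (Fin D) ℂ)) i j‖ ≤ δ)
    (hδbc : ∀ a' d' i j : Fin D, ‖((transferOp A ^ (b + c)) (Matrix.single a' d' 1) -
      ρ d' a' • (1 : Matrix (Fin D) (Fin D) ℂ)) i j‖ ≤ δ)
    (hε : 2 / lam * (δ * (D : ℝ) ^ 2 * Real.sqrt lam⁻¹ +
        (δ * (D : ℝ) ^ 2) ^ 2 * lam⁻¹ ^ 2 * Real.sqrt lam⁻¹) ≤ ε)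
    (hε'0 : 0 ≤ ε') (hrel : ε' * (1 - ε) = ε) :
    (localOp (chainBlock (a + b + c) (a + b) x₀ h₀) ((parentLocalTerm (a + b) A).submatrix
        (fun σ i => σ (chainBlockSite _ _ x₀ h₀ i)) (fun σ i => σ (chainBlockSite _ _ x₀ h₀ i))) *
      localOp (chainBlock (a + b + c) (b + c) x₁ h₁) ((parentLocalTerm (b + c) A).submatrix
        (fun σ i => σ (chainBlockSite _ _ x₁ h₁ i)) (fun σ i => σ (chainBlockSite _ _ x₁ h₁ i))) +
    localOp (chainBlock (a + b + c) (b + c) x₁ h₁) ((parentLocalTerm (b + c) A).submatrix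
        (fun σ i => σ (chainBlockSite _ _ x₁ h₁ i)) (fun σ i => σ (chainBlockSite _ _ x₁ h₁ i))) *
      localOp (chainBlock (a + b + c) (a + b) x₀ h₀) ((parentLocalTerm (a + b) A).submatrix
        (fun σ i => σ (chainBlockSite _ _ x₀ h₀ i)) (fun σ i => σ (chainBlockSite _ _ x₀ h₀ i))) +
    ((ε' : ℝ) : ℂ) •
      (localOp (chainBlock (a + b + c) (a + b) x₀ h₀) ((parentLocalTerm (a + b) A).submatrix
        (fun σ i => σ (chainBlockSite _ _ x₀ h₀ i)) (fun σ i => σ (chainBlockSite _ _ x₀ h₀ i))) +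
      localOp (chainBlock (a + b + c) (b + c) x₁ h₁) ((parentLocalTerm (b + c) A).submatrix
        (fun σ i => σ (chainBlockSite _ _ x₁ h₁ i)) (fun σ i => σ (chainBlockSite _ _ x₁ h₁ i))))).PosSemidef := by
  -- the two block terms and the full projection
  set E : Op (Fin (a + b + c)) q := localOp (chainBlock (a + b + c) (a + b) x₀ h₀)
    ((parentLocalTerm (a + b) A).submatrix (fun σ i => σ (chainBlockSite _ _ x₀ h₀ i))
      (fun σ i => σ (chainBlockSite _ _ x₀ h₀ i))) with hEdef
  set F : Op (Fin (a + b + c)) q := localOp (chainBlock (a + b + c) (b + c) x₁ h₁)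
    ((parentLocalTerm (b + c) A).submatrix (fun σ i => σ (chainBlockSite _ _ x₁ h₁ i))
      (fun σ i => σ (chainBlockSite _ _ x₁ h₁ i))) with hFdef
  set G : Op (Fin (a + b + c)) q := projMatrix (mpsRange (a + b + c) A) with hGdef
  -- `E`, `F` are orthogonal projections
  have hEh : E.IsHermitian :=
    isHermitian_localOp _ ((projMatrix_isHermitian _).submatrix _)
  have hFh : F.IsHermitian :=
    isHermitian_localOp _ ((projMatrix_isHermitian _).submatrix _)
  have hEE : E * E = E := by
    rw [hEdef, ← localOp_submatrix_mul _ (chainBlockSite_bijective _ _ x₀ h₀), parentLocalTerm,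
      projMatrix_mul_self]
  have hFF : F * F = F := by
    rw [hFdef, ← localOp_submatrix_mul _ (chainBlockSite_bijective _ _ x₁ h₁), parentLocalTerm,
      projMatrix_mul_self]
  have hGh : G.IsHermitian := projMatrix_isHermitian _
  have hGG : G * G = G := projMatrix_mul_self _
  -- `G v` is a boundary MPS on the whole chain
  have hGv : ∀ v : TensorIndex (Fin (a + b + c)) q → ℂ, ∃ X : Matrix (Fin D) (Fin D) ℂ,
      G *ᵥ v = mpsWithBoundary (a + b + c) A X := by
    intro v
    have hmem : (mpsRange (a + b + c) A).starProjection (WithLp.toLp 2 v) ∈ mpsRange (a + b + c) A :=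
      Submodule.starProjection_apply_mem _ _
    obtain ⟨X, hX⟩ := exists_mpsWithBoundary_of_mem_mpsRange _ A hmem
    refine ⟨X, ?_⟩
    rw [hGdef, projMatrix_mulVec, ← hX]
  -- `E G = 0`, `F G = 0`
  have hEG : E * G = 0 := by
    refine eq_zero_of_forall_mulVec_eq_zero fun v => ?_
    obtain ⟨X, hX⟩ := hGv v
    rw [← mulVec_mulVec, hX, hEdef]
    exact localOp_chainBlock_parentLocalTerm_mulVec_mpsWithBoundary x₀ h₀ A X
  have hFG : F * G = 0 := by
    refine eq_zero_of_forall_mulVec_eq_zero fun v => ?_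
    obtain ⟨X, hX⟩ := hGv v
    rw [← mulVec_mulVec, hX, hFdef]
    exact localOp_chainBlock_parentLocalTerm_mulVec_mpsWithBoundary x₁ h₁ A X
  -- the projections of the two-projection lemma
  have key := posSemidef_anticommutator_add_smul (G₁ := 1 - E) (G₂ := 1 - F) (G := G)
    (isHermitian_one.sub hEh) (by simp [Matrix.sub_mul, Matrix.mul_sub, hEE])
    (isHermitian_one.sub hFh) (by simp [Matrix.sub_mul, Matrix.mul_sub, hFF]) hGh hGG
    (by rw [Matrix.sub_mul, Matrix.one_mul, hEG, sub_zero])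
    (by rw [Matrix.sub_mul, Matrix.one_mul, hFG, sub_zero])
    (ε := ε) (ε' := ε') (le_trans (by positivity) hε) hε'0 hrel ?_
  · simpa only [sub_sub_cancel] using key
  -- the angle bound, from `fnw_overlap_le`
  intro x y
  set Φv : TensorIndex (Fin (a + b + c)) q → ℂ := (1 - E - G) *ᵥ x with hΦv
  set Ψv : TensorIndex (Fin (a + b + c)) q → ℂ := (1 - F - G) *ᵥ y with hΨv
  -- the curried three-block forms
  set Φ : (Fin a → Fin q) → (Fin b → Fin q) → (Fin c → Fin q) → ℂ :=
    fun u s t => Φv (Fin.append (Fin.append u s) t) with hΦ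
  set Ψ : (Fin a → Fin q) → (Fin b → Fin q) → (Fin c → Fin q) → ℂ :=
    fun u s t => Ψv (Fin.append (Fin.append u s) t) with hΨ
  have hov := fnw_overlap_le A h1 hρ hρ1 hlam hlamρ hδ0 hδlam hδb hδab hδbc Φ Ψ ?_ ?_ ?_ ?_
  · -- translate back to the chain
    have hdot : star Φv ⬝ᵥ Ψv = ∑ u, ∑ s, ∑ t, star (Φ u s t) * Ψ u s t := by
      rw [dotProduct, ← sum_sum_sum_append]
      rfl
    have hnΦ : ‖(WithLp.toLp 2 Φv : EuclideanSpace ℂ (TensorIndex (Fin (a + b + c)) q))‖ =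
        Real.sqrt (∑ u, ∑ s, ∑ t, ‖Φ u s t‖ ^ 2) := by
      rw [EuclideanSpace.norm_eq, ← sum_sum_sum_append]
    have hnΨ : ‖(WithLp.toLp 2 Ψv : EuclideanSpace ℂ (TensorIndex (Fin (a + b + c)) q))‖ =
        Real.sqrt (∑ u, ∑ s, ∑ t, ‖Ψ u s t‖ ^ 2) := by
      rw [EuclideanSpace.norm_eq, ← sum_sum_sum_append]
    rw [hdot, hnΦ, hnΨ]
    refine hov.trans ?_
    exact mul_le_mul_of_nonneg_right (mul_le_mul_of_nonneg_right hε (Real.sqrt_nonneg _))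
      (Real.sqrt_nonneg _)
  · -- prefix slices of `Φv` are boundary MPS
    intro t
    classical
    by_cases hne : Nonempty (Fin a → Fin q) ∧ Nonempty (Fin b → Fin q)
    swap
    · refine ⟨0, fun u s => ?_⟩
      exact (hne ⟨⟨u⟩, ⟨s⟩⟩).elim
    obtain ⟨⟨u₀⟩, ⟨s₀⟩⟩ := hne
    set σ₀ : TensorIndex (Fin (a + b + c)) q := Fin.append (Fin.append u₀ s₀) t with hσ₀
    -- the slice of `x` minus its local projection is a boundary MPS
    set w : (Fin (a + b) → Fin q) → ℂ := fun v =>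
      x (Function.extend (fun i : Fin (a + b) => (⟨x₀ + i, by omega⟩ : Fin (a + b + c))) v σ₀) with hw
    have hmem : WithLp.toLp 2 (w - parentLocalTerm (a + b) A *ᵥ w) ∈ mpsRange (a + b) A := by
      have hP := projMatrix_mulVec (mpsRange (a + b) A)ᗮ (WithLp.toLp 2 w)
      rw [Submodule.starProjection_orthogonal_val] at hP
      have e : w - parentLocalTerm (a + b) A *ᵥ w =
          ((mpsRange (a + b) A).starProjection (WithLp.toLp 2 w)).ofLp := by
        unfold parentLocalTerm
        rw [hP]
        simp
      rw [e]
      simp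
    obtain ⟨B₁, hB₁⟩ := exists_mpsWithBoundary_of_mem_mpsRange _ A hmem
    have hB₁' : mpsWithBoundary (a + b) A B₁ = w - parentLocalTerm (a + b) A *ᵥ w :=
      (WithLp.toLp_injective 2) hB₁
    -- the slice of `G x = ψ_X`
    obtain ⟨X, hX⟩ := hGv x
    refine ⟨B₁ - wordProduct A (fun k : Fin (a + b + c - (x₀ + (a + b))) => σ₀ ⟨x₀ + (a + b) + k, by omega⟩) *
      X * wordProduct A (fun i : Fin x₀ => σ₀ ⟨i, by omega⟩), fun u s => ?_⟩
    have hglue := extend_prefix_append x₀ hx₀ (Fin.append u s) u₀ s₀ t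
    -- evaluate `Φv` at the glued configuration through the slices
    have hEx : (E *ᵥ x) (Fin.append (Fin.append u s) t) =
        (parentLocalTerm (a + b) A *ᵥ w) (Fin.append u s) := by
      have h := congrFun (slice_localOp_chainBlock_submatrix_mulVec x₀ h₀ (parentLocalTerm (a + b) A) x σ₀)
        (Fin.append u s)
      rw [hglue] at h
      exact h
    have hGx : (G *ᵥ x) (Fin.append (Fin.append u s) t) =
        mpsWithBoundary (a + b) A (wordProduct A (fun k : Fin (a + b + c - (x₀ + (a + b))) =>
          σ₀ ⟨x₀ + (a + b) + k, by omega⟩) * X * wordProduct A (fun i : Fin x₀ => σ₀ ⟨i, by omega⟩))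
          (Fin.append u s) := by
      have h := congrFun (mpsWithBoundary_extend_blockSite h₀ A X σ₀) (Fin.append u s)
      rw [hglue] at h
      rw [hX, h]
    have hxx : x (Fin.append (Fin.append u s) t) = w (Fin.append u s) := by
      simp only [hw]
      rw [hglue]
    show ((1 - E - G) *ᵥ x) (Fin.append (Fin.append u s) t) = _
    rw [sub_mulVec, sub_mulVec, one_mulVec, Pi.sub_apply, Pi.sub_apply, hEx, hGx, hxx,
      show w (Fin.append u s) - (parentLocalTerm (a + b) A *ᵥ w) (Fin.append u s) =
        mpsWithBoundary (a + b) A B₁ (Fin.append u s) by rw [hB₁']; rfl]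
    simp only [mpsWithBoundary, Matrix.sub_mul, trace_sub, wordProduct_append, Matrix.mul_assoc]
  · -- suffix slices of `Ψv` are boundary MPS
    intro u
    classical
    by_cases hne : Nonempty (Fin b → Fin q) ∧ Nonempty (Fin c → Fin q)
    swap
    · refine ⟨0, fun s t => ?_⟩
      exact (hne ⟨⟨s⟩, ⟨t⟩⟩).elim
    obtain ⟨⟨s₀⟩, ⟨t₀⟩⟩ := hne
    set σ₀ : TensorIndex (Fin (a + b + c)) q := Fin.append (Fin.append u s₀) t₀ with hσ₀
    set w : (Fin (b + c) → Fin q) → ℂ := fun v =>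
      y (Function.extend (fun i : Fin (b + c) => (⟨x₁ + i, by omega⟩ : Fin (a + b + c))) v σ₀) with hw
    have hmem : WithLp.toLp 2 (w - parentLocalTerm (b + c) A *ᵥ w) ∈ mpsRange (b + c) A := by
      have hP := projMatrix_mulVec (mpsRange (b + c) A)ᗮ (WithLp.toLp 2 w)
      rw [Submodule.starProjection_orthogonal_val] at hP
      have e : w - parentLocalTerm (b + c) A *ᵥ w =
          ((mpsRange (b + c) A).starProjection (WithLp.toLp 2 w)).ofLp := by
        unfold parentLocalTerm
        rw [hP]
        simp
      rw [e]
      simp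
    obtain ⟨C₁, hC₁⟩ := exists_mpsWithBoundary_of_mem_mpsRange _ A hmem
    have hC₁' : mpsWithBoundary (b + c) A C₁ = w - parentLocalTerm (b + c) A *ᵥ w :=
      (WithLp.toLp_injective 2) hC₁
    obtain ⟨X, hX⟩ := hGv y
    refine ⟨C₁ - wordProduct A (fun k : Fin (a + b + c - (x₁ + (b + c))) => σ₀ ⟨x₁ + (b + c) + k, by omega⟩) *
      X * wordProduct A (fun i : Fin x₁ => σ₀ ⟨i, by omega⟩), fun s t => ?_⟩
    have hglue := extend_suffix_append x₁ hx₁ u s s₀ t t₀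
    have hFy : (F *ᵥ y) (Fin.append (Fin.append u s) t) =
        (parentLocalTerm (b + c) A *ᵥ w) (Fin.append s t) := by
      have h := congrFun (slice_localOp_chainBlock_submatrix_mulVec x₁ h₁ (parentLocalTerm (b + c) A) y σ₀)
        (Fin.append s t)
      rw [hglue] at h
      exact h
    have hGy : (G *ᵥ y) (Fin.append (Fin.append u s) t) =
        mpsWithBoundary (b + c) A (wordProduct A (fun k : Fin (a + b + c - (x₁ + (b + c))) =>
          σ₀ ⟨x₁ + (b + c) + k, by omega⟩) * X * wordProduct A (fun i : Fin x₁ => σ₀ ⟨i, by omega⟩))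
          (Fin.append s t) := by
      have h := congrFun (mpsWithBoundary_extend_blockSite h₁ A X σ₀) (Fin.append s t)
      rw [hglue] at h
      rw [hX, h]
    have hyy : y (Fin.append (Fin.append u s) t) = w (Fin.append s t) := by
      simp only [hw]
      rw [hglue]
    show ((1 - F - G) *ᵥ y) (Fin.append (Fin.append u s) t) = _
    rw [sub_mulVec, sub_mulVec, one_mulVec, Pi.sub_apply, Pi.sub_apply, hFy, hGy, hyy,
      show w (Fin.append s t) - (parentLocalTerm (b + c) A *ᵥ w) (Fin.append s t) =
        mpsWithBoundary (b + c) A C₁ (Fin.append s t) by rw [hC₁']; rfl]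
    simp only [mpsWithBoundary, Matrix.sub_mul, trace_sub, wordProduct_append, Matrix.mul_assoc]
  · -- `Φv ⊥ 𝒢_N`
    intro X
    have hvan : (1 - E - G) *ᵥ mpsWithBoundary (a + b + c) A X = 0 := by
      have hEψ : E *ᵥ mpsWithBoundary (a + b + c) A X = 0 :=
        localOp_chainBlock_parentLocalTerm_mulVec_mpsWithBoundary x₀ h₀ A X
      have hmemX : WithLp.toLp 2 (mpsWithBoundary (a + b + c) A X) ∈ mpsRange (a + b + c) A :=
        Submodule.subset_span ⟨X, rfl⟩
      have hGψ : G *ᵥ mpsWithBoundary (a + b + c) A X = mpsWithBoundary (a + b + c) A X := by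
        rw [hGdef, projMatrix_mulVec, Submodule.starProjection_eq_self_iff.2 hmemX]
      rw [sub_mulVec, sub_mulVec, one_mulVec, hEψ, hGψ, sub_zero, sub_self]
    have hherm : (1 - E - G).IsHermitian := (isHermitian_one.sub hEh).sub hGh
    have hdot : star (mpsWithBoundary (a + b + c) A X) ⬝ᵥ Φv = 0 := by
      rw [hΦv, dotProduct_mulVec, ← hherm.eq, ← star_mulVec, hvan, star_zero, zero_dotProduct]
    rw [← hdot, dotProduct, ← sum_sum_sum_append]
    refine Finset.sum_congr rfl fun u _ => Finset.sum_congr rfl fun s _ =>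
      Finset.sum_congr rfl fun t _ => ?_
    simp only [Pi.star_apply, mpsWithBoundary, wordProduct_append, Matrix.mul_assoc]
    rfl
  · -- `Ψv ⊥ 𝒢_N`
    intro X
    have hvan : (1 - F - G) *ᵥ mpsWithBoundary (a + b + c) A X = 0 := by
      have hFψ : F *ᵥ mpsWithBoundary (a + b + c) A X = 0 :=
        localOp_chainBlock_parentLocalTerm_mulVec_mpsWithBoundary x₁ h₁ A X
      have hmemX : WithLp.toLp 2 (mpsWithBoundary (a + b + c) A X) ∈ mpsRange (a + b + c) A :=
        Submodule.subset_span ⟨X, rfl⟩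
      have hGψ : G *ᵥ mpsWithBoundary (a + b + c) A X = mpsWithBoundary (a + b + c) A X := by
        rw [hGdef, projMatrix_mulVec, Submodule.starProjection_eq_self_iff.2 hmemX]
      rw [sub_mulVec, sub_mulVec, one_mulVec, hFψ, hGψ, sub_zero, sub_self]
    have hherm : (1 - F - G).IsHermitian := (isHermitian_one.sub hFh).sub hGh
    have hdot : star (mpsWithBoundary (a + b + c) A X) ⬝ᵥ Ψv = 0 := by
      rw [hΨv, dotProduct_mulVec, ← hherm.eq, ← star_mulVec, hvan, star_zero, zero_dotProduct]
    rw [← hdot, dotProduct, ← sum_sum_sum_append]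
    refine Finset.sum_congr rfl fun u _ => Finset.sum_congr rfl fun s _ =>
      Finset.sum_congr rfl fun t _ => ?_
    simp only [Pi.star_apply, mpsWithBoundary, wordProduct_append, Matrix.mul_assoc]
    rfl

end QLattice

end Literature.MathematicalPhysics.QuantumLattice
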